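import Summits.BirchSwinnertonDyer.BirchSwinnertonDyer.Theorems.PrintCf2RamifiedOffTYZPartnerShaSelmerCount
import HarnessLib

/-!
# Crux `PrintCf2.RamifiedOffTYZOfFacts` (stmt-BirchSwinnertonDyer-20509), line `offtyz-v7`, LEAD cycle 24 (cruxlead-20509 g23), part 6:
# A `2`-TORSION-FREE PARTNER PUTS `E_n` IN THE JUMP-ONE CLASS FOR EVERY SQUARE-FREE `n` (no sector, no `dim S'` hypothesis)

THEOREMS ONLY (no `def`, no named fact, no `sorry`), `--supports stmt-BirchSwinnertonDyer-20509`.  Cycle 21's T1 (`…PartnerShaRigidity`,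
`rhoIndex_ne_one_and_selmerFour_of_partner`) derives from `Ш(A_n)[2] = 0` BOTH `ρ(n) ≠ 0` and the jump-one condition `#Sel₄(E_n) = 2⁶`, under the
sector hypothesis `dim S'(0,−n²) = 2` (the two odd two-prime sectors R1/R2, cycle 21 part 6 and cycle 24 parts 3–4).  READING ITS PROOF: the `dim S'`
hypothesis is used ONLY for `ρ ≠ 0` (the count `#Ш(E_n)[φ]·2^{rank+2} = 2^{dim S'}·#α`); the jump-one half — `Ш(A_n)[ψ̂] = 0 ⟹ Ш(E_n)[2] = Ш(E_n)[φ] =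
ker φ_*`, hence `4c = 0 ⟹ φ_*(2c) = 0 ⟹ 2·φ_*c = 0 ⟹ φ_*c ∈ Ш(A_n)[2] = 0 ⟹ 2c = 0`, so `Ш(E_n)[4] = Ш(E_n)[2]` and `#Sel₄ = 4·4·4` — is SECTOR-FREE.
This part records that:

* §19 ★★ `selmerFour_of_partner_sha_two_eq_bot` — **for EVERY square-free `n` with `rank E_n(ℚ) = 1` and `#Sel₂(E_n) = 2⁵` (category D of rank one,
  ANY number of prime factors, odd or even): `Ш(A_n)[2] = 0 ⟹ #Ш(E_n)[2^∞] = 4 ∧ #Sel₄(E_n) = 2⁶`** — the hypothesis `#Sel₄ = 2⁶` of item 23431 is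
  AUTOMATIC on the whole sub-class {`Ш(A_n)[2] = 0`} = {`#Sel₂(A_n/ℚ) = 4`} (cycle 24 part 5's dictionary): `selmerFour_of_natCard_selmerTwo_partner_eq_four`,
  and the GZK form `selmerFour_of_natCard_selmerTwo_partner_eq_four_of_facts` (`ord_{s=1} L(E_n,s) = 1` in place of the rank).
* §20 `two_pow_selmerRank'_mul_natCard_range_xSqClass_eq` (`Ш(A_n)[2] = 0 ⟹ 2^{dim S'(0,−n²)} · #α(E_n(ℚ)) = 32`) and ★ `rho_dichotomy_of_partner_sha_two_eq_bot`
  (`n > 1`): **either `ρ(n) ≠ 0 ∧ dim S' = 2` (the R1/R2 shape) or `ρ(n) = 0 ∧ dim S' = 3`** — where T1's sector hypothesis really sits.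
Contrapositive (T3, sector-free): `#Sel₄(E_n) ≠ 2⁶ ⟹ Ш(A_n)[2] ≠ 0` — every census B-member has a partner with `2`-torsion in `Ш`, for every `k`.
Beyond-print theorem: NO (descent bookkeeping, Silverman X.4.2 / X.6.2(c)).  BSD is not proved by any of this; C⁺ (23431) and the crux stay OPEN.

References: [cite: SilvermanAEC2009, Thm. X.4.2(a), Prop. X.4.9, proof of Prop. X.6.2(c)]; [cite: TianYuanZhang2017, §1 (ρ(n), A_n)]; [cite: SilvermanTate2015, §3.6];
[cite: Darmon2004, Thm. 3.22]; tree: cycle 21 parts 1–3 (`…PartnerSha{Cassels,Rho,Rigidity}`), cycle 24 part 5 (`…PartnerShaSelmerCount`), `SecondDescentShaExponentProofs`,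
`TwoIsogenyShaTwoTorsionEqPhi`.
-/

noncomputable section

open scoped Classical

open WeierstrassCurve Literature.NumberTheory.EllipticCurves
open WeierstrassCurve.Affine WeierstrassCurve.Affine.Point
  Literature.NumberTheory.EllipticCurves.TwoDescentLocal
  Literature.NumberTheory.EllipticCurves.Rank1Residual
  Literature.NumberTheory.EllipticCurves.TianYuanZhang2017
  Literature.NumberTheory.EllipticCurves.TianYuanZhang2017.RhoMonskyKernel

set_option autoImplicit false

namespace Summit.BirchSwinnertonDyer.PrintCf2.PartnerSha

/-! ## §19 The jump-one half of T1 is sector-free -/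

section SectorFree

variable {n : ℕ}

/-- **A `2`-TORSION-FREE PARTNER FORCES THE JUMP-ONE CONDITION, FOR EVERY SQUARE-FREE `n`.**  Square-free `n`, `rank E_n(ℚ) = 1`, `#Sel₂(E_n) = 2⁵`,
and `Ш(A_n/ℚ)[2] = 0` for the partner `A_n = E_n'`.  Then `Ш(E_n)[2^∞] = Ш(E_n)[2]` has order `4` and `#Sel₄(E_n) = 2⁶`.  NO `dim S'` / sector hypothesis
(cycle 21's T1 minus its `ρ`-conclusion): `Ш(A_n)[ψ̂] = 0 ⟹ Ш(E_n)[2] = Ш(E_n)[φ] = ker φ_*` (AEC X.6.2(c)), and `4c = 0 ⟹ 2c ∈ ker φ_* ⟹ φ_* c ∈ Ш(A_n)[2] = 0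
⟹ c ∈ Ш(E_n)[φ] ⟹ 2c = 0`. [cite: SilvermanAEC2009, Thm. X.4.2(a), proof of Prop. X.6.2(c)] [cite: TianYuanZhang2017, §1 (A_n)] -/
theorem selmerFour_of_partner_sha_two_eq_bot (hsq : Squarefree n)
    (hr : haveI := isElliptic_congruentNumberCurve hsq.ne_zero; (congruentNumberCurve n).mordellWeilRank = 1)
    (h₂ : haveI := isElliptic_congruentNumberCurve hsq.ne_zero; Nat.card ((congruentNumberCurve n).selmerGroup 2) = 2 ^ 5)
    (hA : ∀ c ∈ (congruentNumberCurve n).twoIsogenyCodomain.sha, 2 • c = 0 → c = 0) :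
    haveI := isElliptic_congruentNumberCurve hsq.ne_zero
    Nat.card (AddCommGroup.primaryComponent (congruentNumberCurve n).sha 2) = 4 ∧
      Nat.card ((congruentNumberCurve n).selmerGroup 4) = 2 ^ 6 := by
  have hn := hsq.ne_zero
  haveI := isElliptic_congruentNumberCurve hn
  -- (a) `Ш(A_n) ∩ im Ξ_{A_n} = ⊥`
  have hA' : (congruentNumberCurve n).twoIsogenyCodomain.sha ⊓
      AddMonoidHom.range (G := Additive (SqUnits ℚ)) (congruentNumberCurve n).twoIsogenyCodomain.twoIsogenyTorsorHom = ⊥ := by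
    rw [eq_bot_iff]
    rintro c ⟨hc, ⟨x, hx⟩⟩
    rw [AddSubgroup.mem_bot]
    exact hA c hc (by rw [← hx]; exact two_nsmul_twoIsogenyTorsorHom _ x)
  -- (b) `Ш(E_n)[2] = Ш(E_n)[φ]`
  have hEq := sha_inf_torsionBy_two_eq_sha_inf_range (congruentNumberCurve n) hA'
  -- (c) `4c = 0 ⟹ 2c = 0` on `Ш(E_n)` (no `dim S'` input)
  have hstep : ∀ c ∈ (congruentNumberCurve n).sha, 2 • (2 • c) = 0 → 2 • c = 0 := by
    intro c hc h4c
    have h2c : 2 • c ∈ (congruentNumberCurve n).sha ⊓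
        AddMonoidHom.range (G := Additive (SqUnits ℚ)) (congruentNumberCurve n).twoIsogenyTorsorHom := by
      rw [← hEq]; exact ⟨(congruentNumberCurve n).sha.nsmul_mem hc 2, AddSubgroup.torsionBy.nsmul_iff.mpr h4c⟩
    have hker : 2 • c ∈ (galH1Map (congruentNumberCurve n).twoIsogenyGeomHom
        (twoIsogenyGeomHom_smul (congruentNumberCurve n))).ker := by
      rw [← range_twoIsogenyTorsorHom_eq_ker_galH1Map]; exact h2c.2
    have hker' : 2 • galH1Map (congruentNumberCurve n).twoIsogenyGeomHom
        (twoIsogenyGeomHom_smul (congruentNumberCurve n)) c = 0 := by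
      rw [← map_nsmul]; exact hker
    have hφc : galH1Map (congruentNumberCurve n).twoIsogenyGeomHom
        (twoIsogenyGeomHom_smul (congruentNumberCurve n)) c = 0 :=
      hA _ (galH1Map_mem_sha (congruentNumberCurve n).twoIsogenyGeomHom (twoIsogenyGeomHom_smul (congruentNumberCurve n))
        (congruentNumberCurve n).twoIsogeny.hasLocalPointsMaps_toAddMonoidHom hc) hker'
    have hcker : c ∈ (galH1Map (congruentNumberCurve n).twoIsogenyGeomHom
        (twoIsogenyGeomHom_smul (congruentNumberCurve n))).ker := hφc
    have hc' : c ∈ (congruentNumberCurve n).sha ⊓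
        AddMonoidHom.range (G := Additive (SqUnits ℚ)) (congruentNumberCurve n).twoIsogenyTorsorHom := by
      refine ⟨hc, ?_⟩
      rw [range_twoIsogenyTorsorHom_eq_ker_galH1Map]
      exact hcker
    rw [← hEq] at hc'
    exact AddSubgroup.torsionBy.nsmul_iff.mp hc'.2
  -- (d) `Ш(E_n)[4] = Ш(E_n)[2]` as subgroups of `Ш`, so `#Ш[4] = 4` and `#Sel₄ = 4·4·4`
  have h42 : AddSubgroup.torsionBy (↥(congruentNumberCurve n).sha) ((4 : ℕ) : ℤ) =
      AddSubgroup.torsionBy (↥(congruentNumberCurve n).sha) ((2 : ℕ) : ℤ) := by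
    ext x
    rw [AddSubgroup.torsionBy.nsmul_iff, AddSubgroup.torsionBy.nsmul_iff]
    constructor
    · intro hx
      have hx' : 2 • (2 • (x : (congruentNumberCurve n).galH1)) = 0 := by
        rw [← mul_nsmul]
        have := congrArg Subtype.val hx
        simpa using this
      exact Subtype.ext (by simpa using hstep x x.2 hx')
    · intro hx
      rw [show (4 : ℕ) = 2 * 2 by norm_num, mul_nsmul, hx, nsmul_zero]
  have hsha2 : Nat.card (AddSubgroup.torsionBy (↥(congruentNumberCurve n).sha) (2 : ℤ)) = 4 := by
    have h := (MonskySelmerParity.natCard_shaTorsionBy_two_eq_pow hn (s := 3) (by simpa using h₂)).2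
    rw [hr] at h
    simpa using h
  have hsha4 : Nat.card (AddSubgroup.torsionBy (↥(congruentNumberCurve n).sha) ((4 : ℕ) : ℤ)) = 4 := by
    rw [h42]; simpa using hsha2
  have hsel := (congruentNumberCurve n).natCard_selmerGroup_eq_of_natCard_eq four_ne_zero (t := 4) (c := 4)
    (by convert natCard_torsionBy_four_congruentNumberCurve hsq; norm_num) hsha4
  rw [hr] at hsel
  simp only [Nat.cast_ofNat] at hsel
  have h₄ : Nat.card ((congruentNumberCurve n).selmerGroup 4) = 2 ^ 6 := by
    rw [hsel]; norm_num
  exact ⟨natCard_primaryComponent_sha_two_eq_four_of_selmerFour n hsq hr h₂ h₄, h₄⟩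

/-- **The `#Sel₄` hypothesis of item 23431 is AUTOMATIC on {`#Sel₂(A_n/ℚ) = 4`}, for every square-free `n`** (rank `1`, `#Sel₂(E_n) = 2⁵`) — §19 read through
the dictionary `partner_sha_two_trivial_iff_natCard_selmerTwo` (cycle 24 part 5). [cite: SilvermanAEC2009, Thm. X.4.2] -/
theorem selmerFour_of_natCard_selmerTwo_partner_eq_four (hsq : Squarefree n)
    (hr : haveI := isElliptic_congruentNumberCurve hsq.ne_zero; (congruentNumberCurve n).mordellWeilRank = 1)
    (h₂ : haveI := isElliptic_congruentNumberCurve hsq.ne_zero; Nat.card ((congruentNumberCurve n).selmerGroup 2) = 2 ^ 5)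
    (hA : haveI := isElliptic_congruentNumberCurve hsq.ne_zero; Nat.card ((congruentNumberCurve n).twoIsogenyCodomain.selmerGroup 2) = 4) :
    haveI := isElliptic_congruentNumberCurve hsq.ne_zero
    Nat.card ((congruentNumberCurve n).selmerGroup 4) = 2 ^ 6 := by
  haveI := isElliptic_congruentNumberCurve hsq.ne_zero
  exact (selmerFour_of_partner_sha_two_eq_bot hsq hr h₂ ((partner_sha_two_trivial_iff_natCard_selmerTwo hsq hr).mpr hA)).2

/-- **GZK form** (the route's currency: `ord_{s=1} L(E_n, s) = 1` and `rank_eq_analyticRank_of_analyticRank_le_one`): for every square-free `n` with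
`ord_{s=1} L(E_n,s) = 1`, `#Sel₂(E_n) = 2⁵` and `#Sel₂(A_n/ℚ) = 4`, the jump-one hypothesis `#Sel₄(E_n) = 2⁶` of C⁺ holds.
[cite: SilvermanAEC2009, Thm. X.4.2] [cite: Darmon2004, Thm. 3.22] -/
theorem selmerFour_of_natCard_selmerTwo_partner_eq_four_of_facts (hGZK : rank_eq_analyticRank_of_analyticRank_le_one)
    (hsq : Squarefree n)
    (hr1 : haveI := isElliptic_congruentNumberCurve hsq.ne_zero; (congruentNumberCurve n).analyticRank = 1)
    (h₂ : haveI := isElliptic_congruentNumberCurve hsq.ne_zero; Nat.card ((congruentNumberCurve n).selmerGroup 2) = 2 ^ 5)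
    (hA : haveI := isElliptic_congruentNumberCurve hsq.ne_zero; Nat.card ((congruentNumberCurve n).twoIsogenyCodomain.selmerGroup 2) = 4) :
    haveI := isElliptic_congruentNumberCurve hsq.ne_zero
    Nat.card ((congruentNumberCurve n).selmerGroup 4) = 2 ^ 6 := by
  haveI := isElliptic_congruentNumberCurve hsq.ne_zero
  have hrank : (congruentNumberCurve n).mordellWeilRank = 1 := (hGZK _ hr1.le).1.trans hr1
  exact selmerFour_of_natCard_selmerTwo_partner_eq_four hsq hrank h₂ hA

/-- **T3, sector-free**: outside the jump-one class (`#Sel₄(E_n) ≠ 2⁶`; the census B-members, any number of prime factors) the partner ALWAYS carries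
`2`-torsion in `Ш`: `#Sel₂(A_n/ℚ) ≠ 4`. [cite: SilvermanAEC2009, Thm. X.4.2, proof of Prop. X.6.2(c)] -/
theorem natCard_selmerTwo_partner_ne_four_of_not_selmerFour' (hsq : Squarefree n)
    (hr : haveI := isElliptic_congruentNumberCurve hsq.ne_zero; (congruentNumberCurve n).mordellWeilRank = 1)
    (h₂ : haveI := isElliptic_congruentNumberCurve hsq.ne_zero; Nat.card ((congruentNumberCurve n).selmerGroup 2) = 2 ^ 5)
    (h₄ : haveI := isElliptic_congruentNumberCurve hsq.ne_zero; Nat.card ((congruentNumberCurve n).selmerGroup 4) ≠ 2 ^ 6) :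
    haveI := isElliptic_congruentNumberCurve hsq.ne_zero
    Nat.card ((congruentNumberCurve n).twoIsogenyCodomain.selmerGroup 2) ≠ 4 :=
  fun hA => h₄ (selmerFour_of_natCard_selmerTwo_partner_eq_four hsq hr h₂ hA)

/-! ## §20 Where T1's sector hypothesis sits: `2^{dim S'} · #α = 32`, so `ρ ≠ 0 ⟺ dim S' = 2` on {`Ш(A_n)[2] = 0`} -/

/-- **`Ш(A_n)[2] = 0 ⟹ 2^{dim S'(0,−n²)} · #α(E_n(ℚ)) = 32`** (square-free `n`, rank `1`, `#Sel₂(E_n) = 2⁵`): the count `#Ш(E_n)[φ]·2^{rank+2} =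
2^{dim S'}·#α` with `Ш(E_n)[φ] = Ш(E_n)[2]` of order `4`. [cite: SilvermanAEC2009, Thm. X.4.2(a), Prop. X.4.9] [cite: SilvermanTate2015, §3.6] -/
theorem two_pow_selmerRank'_mul_natCard_range_xSqClass_eq (hsq : Squarefree n)
    (hr : haveI := isElliptic_congruentNumberCurve hsq.ne_zero; (congruentNumberCurve n).mordellWeilRank = 1)
    (h₂ : haveI := isElliptic_congruentNumberCurve hsq.ne_zero; Nat.card ((congruentNumberCurve n).selmerGroup 2) = 2 ^ 5)
    (hA : ∀ c ∈ (congruentNumberCurve n).twoIsogenyCodomain.sha, 2 • c = 0 → c = 0) :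
    haveI := isElliptic_congruentNumberCurve hsq.ne_zero
    2 ^ twoIsogenySelmerRank' 0 (-((n : ℤ) ^ 2)) * Nat.card (Set.range (congruentNumberCurve n).xSqClass) = 32 := by
  have hn := hsq.ne_zero
  haveI := isElliptic_congruentNumberCurve hn
  have hA' : (congruentNumberCurve n).twoIsogenyCodomain.sha ⊓
      AddMonoidHom.range (G := Additive (SqUnits ℚ)) (congruentNumberCurve n).twoIsogenyCodomain.twoIsogenyTorsorHom = ⊥ := by
    rw [eq_bot_iff]
    rintro c ⟨hc, ⟨x, hx⟩⟩
    rw [AddSubgroup.mem_bot]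
    exact hA c hc (by rw [← hx]; exact two_nsmul_twoIsogenyTorsorHom _ x)
  have hEq := sha_inf_torsionBy_two_eq_sha_inf_range (congruentNumberCurve n) hA'
  have h4 : Nat.card ↥((congruentNumberCurve n).sha ⊓
      AddMonoidHom.range (G := Additive (SqUnits ℚ)) (congruentNumberCurve n).twoIsogenyTorsorHom) = 4 := by
    rw [← hEq]; exact natCard_sha_inf_torsionBy_two_eq_four hn hr h₂
  have hcount := natCard_shaPhi_mul_two_pow_congruent hn
  rw [h4, hr, show (2 : ℕ) ^ (1 + 2) = 8 by norm_num] at hcount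
  omega

/-- **THE `ρ`-DICHOTOMY ON {`Ш(A_n)[2] = 0`} (square-free `n > 1`, rank `1`, `#Sel₂(E_n) = 2⁵`): either `ρ(n) ≠ 0` and `dim S'(0,−n²) = 2` (the shape
of the odd two-prime sectors R1/R2, where T1 gives `ρ = 1`), or `ρ(n) = 0` and `dim S'(0,−n²) = 3`.**  (`#α = 8` resp. `4` by `natCard_range_xSqClass_eq_of_rank_one`.)
So T1's hypothesis `dim S' = 2` is exactly the choice of the first branch. [cite: TianYuanZhang2017, §1 (ρ(n))] [cite: SilvermanAEC2009, Thm. X.4.2(a), Prop. X.4.9] -/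
theorem rho_dichotomy_of_partner_sha_two_eq_bot (hsq : Squarefree n) (hn1 : 1 < n)
    (hr : haveI := isElliptic_congruentNumberCurve hsq.ne_zero; (congruentNumberCurve n).mordellWeilRank = 1)
    (h₂ : haveI := isElliptic_congruentNumberCurve hsq.ne_zero; Nat.card ((congruentNumberCurve n).selmerGroup 2) = 2 ^ 5)
    (hA : ∀ c ∈ (congruentNumberCurve n).twoIsogenyCodomain.sha, 2 • c = 0 → c = 0) :
    ((rhoSubgroup n).index ≠ 1 ∧ twoIsogenySelmerRank' 0 (-((n : ℤ) ^ 2)) = 2) ∨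
      ((rhoSubgroup n).index = 1 ∧ twoIsogenySelmerRank' 0 (-((n : ℤ) ^ 2)) = 3) := by
  have hn := hsq.ne_zero
  haveI := isElliptic_congruentNumberCurve hn
  have hkey := two_pow_selmerRank'_mul_natCard_range_xSqClass_eq hsq hr h₂ hA
  obtain ⟨h0, h1⟩ := natCard_range_xSqClass_eq_of_rank_one hsq hn1 hr
  by_cases hρ : (rhoSubgroup n).index = 1
  · right
    refine ⟨hρ, ?_⟩
    rw [h0 hρ] at hkey
    have h8 : 2 ^ twoIsogenySelmerRank' 0 (-((n : ℤ) ^ 2)) = 2 ^ 3 := by omega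
    exact Nat.pow_right_injective le_rfl h8
  · left
    refine ⟨hρ, ?_⟩
    rw [h1 hρ] at hkey
    have h4 : 2 ^ twoIsogenySelmerRank' 0 (-((n : ℤ) ^ 2)) = 2 ^ 2 := by omega
    exact Nat.pow_right_injective le_rfl h4

end SectorFree

end Summit.BirchSwinnertonDyer.PrintCf2.PartnerSha

end
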